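import Mathlib
import Summits.CriticalPhenomena.CardyFormulaZ2.Theorems.CardySelfRefinementDefs
import Summits.CriticalPhenomena.CardyFormulaZ2.Theorems.CardySelfRefinementRussoDriftModel
import Summits.CriticalPhenomena.CardyFormulaZ2.Theorems.CardySelfRefinementRussoDriftPolynomial
import Summits.CriticalPhenomena.CardyFormulaZ2.Theorems.CardySelfRefinementTrivialSectorRateStubFourArmAboveOneSecondMomentTools
import Summits.CriticalPhenomena.CardyFormulaZ2.Theorems.CardySelfRefinementTrivialSectorRateStubFourArmAboveOneCircuitBitsLocality
import Literature.Probability.Percolation.CrossingClusterCount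
import HarnessLib

/-!
# Helper (M2), part 3, of stub `stub_fourArmAboveOne`, line `far-field-is-a-quarter-turn`
(crux `TrivialSectorRate`, stmt-CriticalPhenomena-10266): the BK-type TAIL BOUND
`M_k(Z ≥ n) ≤ M_k(A)^n` for the number of crossing clusters, `k ≤ 3`

van den Berg–Nolin's input (eq:upper_bd_C) of the crossing-cluster second moment `E[Z²] ≤ c̄²`
(the field `E[X²] ≤ 1`, `X = Z/2`, of the Garban scheme data `hS` of
`fourArmAboveOneAlong_of_garbanScheme`), for the DEPENDENT model `M_k(q)`, `k ≤ 3`: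

* `readout_preimage_subset_disjointOccurrencePow` — under the second read-out `rd` of the coins
  (`exists_readout`), `rd ⁻¹' {Z ≥ n} ⊆ (rd ⁻¹' A) □ ⋯ □ (rd ⁻¹' A)` ON THE COIN SPACE: the open walk
  of each of `n` distinct crossing clusters is certified by the coins `e₀ ↦ {shared}`,
  `e_i ↦ {selector, shared}` (selector on) / `{selector, own_i}` (selector off), non-axial
  `e ↦ {own}`, and certificates of distinct clusters are disjoint — a common shared coin with the
  selector on opens the (`≤ 3`, consecutive) sub-edges of the bundle, a common selector picks two of
  `e₁`, `e₂`, which share a vertex, and a common own coin is a common edge; in each case the two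
  clusters would meet;
* `M_real_setOf_le_numCrossingClusters_le_pow` (registered helper) —
  **`M_k(q)(Z ≥ n) ≤ M_k(q)(boxCrossingEvent N R)^n`** by iterated Reimer on the coin product
  (`prodBernoulli_real_disjointOccurrencePow_le`) and the law identity of the second read-out.

With the RSW input `M_k(γ s)(boxCrossingEvent N (K₀ N)) ≤ 1/2` (dual circuits in `log K₀` separated
annuli, `circuitsAlong` + `real_biInter_compl_dualCircuitInAnnulusAt_eq_prod`) this gives
`E[Z²] ≤ 3` along the path exactly as in `integral_numCrossingClusters_sq_le`.

References: J. van den Berg, P. Nolin, Progr. Probab. 77 (2020), §3 (eq:upper_bd_C), §5.2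
(G-EZ-bnd); D. Reimer, Combin. Probab. Comput. 9 (2000); G. Grimmett, *Percolation* (1999), §2.3.

Target file:
`Summits/CriticalPhenomena/CardyFormulaZ2/Theorems/CardySelfRefinementTrivialSectorRateStubFourArmAboveOneSecondMomentTail.lean`.
-/

noncomputable section

namespace Summit.CriticalPhenomena.CardyFormulaZ2.Theorems.CardySelfRefinement.FarField

open scoped Classical
open Set MeasureTheory ProbabilityTheory SimpleGraph
open Literature.Probability.LatticeModels Literature.Probability.Percolation
open Literature.Probability.Percolation.QuadCrossing
open Summit.CriticalPhenomena.CardyFormulaZ2.Theses.CardySelfRefinement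

/-! ### `{Z ≥ n}` pulls back into an `n`-fold COIN-disjoint occurrence of the crossing event -/

/-- **Distinct crossing clusters have coin-disjoint certificates under the second read-out
(`k ≤ 3`).**  If the configuration read (through the second read-out `rd`) from the coins `S` has
`n` distinct open clusters of `B(R)` joining `B(N)` to `‖·‖_∞ = R`, then `S` lies in the `n`-fold
disjoint occurrence, ON THE COIN SPACE, of the pull-back of the crossing event
`boxCrossingEvent N R`: the open walk of each cluster is certified by the coins
`e₀ ↦ {shared}`, `e_i ↦ {selector, shared}` (selector on) / `{selector, own_i}` (selector off),
non-axial `e ↦ {own}`, and certificates of walks in distinct clusters are disjoint — a common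
shared coin with the selector on forces all (`≤ 3`, consecutive) sub-edges of the bundle open, a
common selector forces two of the sub-edges `e₁`, `e₂`, which share a vertex; either way the two
clusters would meet. -/
theorem readout_preimage_subset_disjointOccurrencePow {k : ℕ} (hk : 0 < k) (hk3 : k ≤ 3)
    {rd : Set Coin → Set (Sym2 (Site 2))}
    (hrd : ∀ (S : Set Coin) (v : Site 2) (d : Fin 2), edgeOf (v, d) ∈ rd S ↔ (if ax k (v, d) then
          ((tb k (v, d), d, (2 : Fin 3)) ∈ S ∧ (tb k (v, d), d, (1 : Fin 3)) ∈ S) ∨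
            ((tb k (v, d), d, (2 : Fin 3)) ∉ S ∧
              (((∀ i, (k : ℤ) ∣ v i) ∧ (tb k (v, d), d, (1 : Fin 3)) ∈ S) ∨
                ((¬ ∀ i, (k : ℤ) ∣ v i) ∧ (v, d, (0 : Fin 3)) ∈ S)))
        else (v, d, (0 : Fin 3)) ∈ S))
    (hrde : ∀ (S : Set Coin) (e : Sym2 (Site 2)), e ∈ rd S → ∃ vd : Site 2 × Fin 2, e = edgeOf vd)
    (N R n : ℕ) :
    rd ⁻¹' {ω | n ≤ numCrossingClusters ω N R} ⊆
      disjointOccurrencePow (rd ⁻¹' boxCrossingEvent N R) n := by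
  intro S hS
  rw [Set.mem_preimage, Set.mem_setOf_eq, numCrossingClusters] at hS
  letI := Fintype.ofFinite {C // IsCrossingCluster (rd S) N R C}
  rw [Nat.card_eq_fintype_card] at hS
  obtain ⟨ι, -⟩ : ∃ f : Fin n ↪ {C // IsCrossingCluster (rd S) N R C}, True :=
    ⟨(Fin.castLEEmb hS).trans (Fintype.equivFin _).symm.toEmbedding, trivial⟩
  have hwalk : ∀ i : Fin n, ∃ w : (boxOpenGraph (rd S) R).Walk (innerRep (ι i)) (outerRep (ι i)), True :=
    fun i => by
      have hr : (boxOpenGraph (rd S) R).Reachable (innerRep (ι i)) (outerRep (ι i)) :=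
        ConnectedComponent.exact ((mk_innerRep (ι i)).trans (mk_outerRep (ι i)).symm)
      obtain ⟨w⟩ := hr
      exact ⟨w, trivial⟩
  choose w _ using hwalk
  -- vertices of the walks and their clusters
  have hclu : ∀ (i : Fin n) (a : Site 2), a ∈ (w i).support →
      (boxOpenGraph (rd S) R).connectedComponentMk a = (ι i).1 := by
    intro i a ha
    rw [← mk_innerRep (ι i)]
    exact (ConnectedComponent.sound ((w i).takeUntil a ha).reachable).symm
  have hsame : ∀ (i j : Fin n) (a : Site 2), a ∈ (w i).support → a ∈ (w j).support → i = j :=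
    fun i j a hai haj => ι.injective (Subtype.ext ((hclu i a hai).symm.trans (hclu j a haj)))
  have hadj : ∀ (i j : Fin n) (a b : Site 2), a ∈ (w i).support → b ∈ (w j).support →
      (boxOpenGraph (rd S) R).Adj a b → i = j := by
    intro i j a b ha hb hab
    refine ι.injective (Subtype.ext ?_)
    rw [← hclu i a ha, ← hclu j b hb]
    exact ConnectedComponent.sound hab.reachable
  -- edges of the walks
  have hedge : ∀ (i : Fin n) (v : Site 2) (d : Fin 2), edgeOf (v, d) ∈ (w i).edges →
      edgeOf (v, d) ∈ rd S ∧ v ∈ box 2 R ∧ v + dirVec d ∈ box 2 R ∧ v ∈ (w i).support ∧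
        v + dirVec d ∈ (w i).support := by
    intro i v d he
    have he' := (w i).edges_subset_edgeSet he
    have hadj' : (boxOpenGraph (rd S) R).Adj v (v + dirVec d) := by rwa [← mem_edgeSet]
    obtain ⟨hmem, hx, hy, -⟩ := boxOpenGraph_adj.1 hadj'
    exact ⟨hmem, hx, hy, (w i).fst_mem_support_of_mem_edges he, (w i).snd_mem_support_of_mem_edges he⟩
  -- the sub-edges of a bundle whose selector and shared coin are on are all open
  have hsub : ∀ (u : Site 2) (d : Fin 2) (p : ℕ), p < k → (u, d, (2 : Fin 3)) ∈ S → (u, d, (1 : Fin 3)) ∈ S →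
      edgeOf ((fun i => (k : ℤ) * u i + (p : ℤ) * dirVec d i), d) ∈ rd S := by
    intro u d p hp hsel hsh
    have hk0 : (k : ℤ) ≠ 0 := by exact_mod_cast hk.ne'
    have hax : ax k ((fun i => (k : ℤ) * u i + (p : ℤ) * dirVec d i), d) := by
      show (k : ℤ) ∣ (k : ℤ) * u (if d = 0 then 1 else 0) + (p : ℤ) * dirVec d (if d = 0 then 1 else 0)
      have hne : (if d = 0 then (1 : Fin 2) else 0) ≠ d := by fin_cases d <;> decide
      rw [dirVec_apply_of_ne hne, mul_zero, add_zero]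
      exact dvd_mul_right _ _
    have htb : tb k ((fun i => (k : ℤ) * u i + (p : ℤ) * dirVec d i), d) = u := by
      funext i
      simp only [tb]
      by_cases hid : i = d
      · subst hid
        rw [dirVec_apply_self, mul_one, add_comm, Int.add_mul_ediv_left _ _ hk0,
          Int.ediv_eq_zero_of_lt (by positivity) (by exact_mod_cast hp), zero_add]
      · rw [dirVec_apply_of_ne hid, mul_zero, add_zero, Int.mul_ediv_cancel_left _ hk0]
    rw [hrd]
    rw [if_pos hax, htb]
    exact Or.inl ⟨hsel, hsh⟩
  -- certificates
  set cert : Site 2 × Fin 2 → Set Coin := fun vd =>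
    if ax k vd then
      (if (k : ℤ) ∣ vd.1 vd.2 then {(tb k vd, vd.2, (1 : Fin 3))}
        else if (tb k vd, vd.2, (2 : Fin 3)) ∈ S then {(tb k vd, vd.2, (2 : Fin 3)), (tb k vd, vd.2, (1 : Fin 3))}
        else {(tb k vd, vd.2, (2 : Fin 3)), (vd.1, vd.2, (0 : Fin 3))})
    else {(vd.1, vd.2, (0 : Fin 3))} with hcert
  set K : Fin n → Set Coin := fun i => ⋃ vd ∈ {vd : Site 2 × Fin 2 | edgeOf vd ∈ (w i).edges}, cert vd with hK
  refine mem_disjointOccurrencePow_of_certificates K (fun i S' hS' => ?_) (fun i j hij => ?_)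
  · -- (1) the certificate of the `i`-th walk certifies a crossing
    have hagree : ∀ vd : Site 2 × Fin 2, edgeOf vd ∈ (w i).edges → ∀ c ∈ cert vd, (c ∈ S' ↔ c ∈ S) :=
      fun vd hvd c hc => hS' c (Set.mem_iUnion₂.2 ⟨vd, hvd, hc⟩)
    have hopen : ∀ e ∈ (w i).edges, e ∈ (boxOpenGraph (rd S') R).edgeSet := by
      intro e he
      have he' := (w i).edges_subset_edgeSet he
      induction e using Sym2.ind with
      | h x y =>
        rw [mem_edgeSet] at he' ⊢
        obtain ⟨hxy, hx, hy, hne⟩ := boxOpenGraph_adj.1 he'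
        refine boxOpenGraph_adj.2 ⟨?_, hx, hy, hne⟩
        obtain ⟨⟨v, d⟩, hvd⟩ := hrde S _ hxy
        rw [hvd] at hxy he ⊢
        have hag := hagree (v, d) he
        have hO := (hrd S v d).1 hxy
        rw [hrd]
        by_cases hax : ax k (v, d)
        · rw [if_pos hax] at hO ⊢
          by_cases hdv : (k : ℤ) ∣ v d
          · -- first sub-edge: the shared coin certifies
            have hall : ∀ i, (k : ℤ) ∣ v i := (forall_dvd_iff_of_ax hax).2 hdv
            have hsh : (tb k (v, d), d, (1 : Fin 3)) ∈ S := by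
              rcases hO with ⟨-, h⟩ | ⟨-, ⟨-, h⟩ | ⟨h, -⟩⟩
              · exact h
              · exact h
              · exact absurd hall h
            have hsh' : (tb k (v, d), d, (1 : Fin 3)) ∈ S' :=
              (hag _ (by simp [hcert, hax, hdv])).2 hsh
            by_cases hsel' : (tb k (v, d), d, (2 : Fin 3)) ∈ S'
            · exact Or.inl ⟨hsel', hsh'⟩
            · exact Or.inr ⟨hsel', Or.inl ⟨hall, hsh'⟩⟩
          · have hnall : ¬ ∀ i, (k : ℤ) ∣ v i := fun h => hdv (h d)
            by_cases hsel : (tb k (v, d), d, (2 : Fin 3)) ∈ S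
            · have hsh : (tb k (v, d), d, (1 : Fin 3)) ∈ S := by
                rcases hO with ⟨-, h⟩ | ⟨h, -⟩
                · exact h
                · exact absurd hsel h
              have hsel' : (tb k (v, d), d, (2 : Fin 3)) ∈ S' := (hag _ (by simp [hcert, hax, hdv, hsel])).2 hsel
              have hsh' : (tb k (v, d), d, (1 : Fin 3)) ∈ S' := (hag _ (by simp [hcert, hax, hdv, hsel])).2 hsh
              exact Or.inl ⟨hsel', hsh'⟩
            · have hown : (v, d, (0 : Fin 3)) ∈ S := by
                rcases hO with ⟨h, -⟩ | ⟨-, ⟨h, -⟩ | ⟨-, h⟩⟩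
                · exact absurd h hsel
                · exact absurd h hnall
                · exact h
              have hsel' : (tb k (v, d), d, (2 : Fin 3)) ∉ S' := fun h =>
                hsel ((hag _ (by simp [hcert, hax, hdv, hsel])).1 h)
              have hown' : (v, d, (0 : Fin 3)) ∈ S' := (hag _ (by simp [hcert, hax, hdv, hsel])).2 hown
              exact Or.inr ⟨hsel', Or.inr ⟨hnall, hown'⟩⟩
        · rw [if_neg hax] at hO ⊢
          exact (hag _ (by simp [hcert, hax])).2 hO
    exact ⟨innerRep (ι i), innerRep_mem (ι i), outerRep (ι i), outerRep_mem (ι i),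
      ((w i).transfer (boxOpenGraph (rd S') R) hopen).reachable⟩
  · -- (2) certificates of distinct clusters are disjoint
    refine Set.disjoint_left.2 fun c hci hcj => hij ?_
    obtain ⟨⟨v, d⟩, hvd, hc⟩ := Set.mem_iUnion₂.1 hci
    obtain ⟨⟨v', d'⟩, hvd', hc'⟩ := Set.mem_iUnion₂.1 hcj
    simp only [Set.mem_setOf_eq] at hvd hvd'
    obtain ⟨hrdv, hbv, hbv1, hsv, hsv1⟩ := hedge i v d hvd
    obtain ⟨hrdv', hbv', hbv1', hsv', hsv1'⟩ := hedge j v' d' hvd'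
    -- a common vertex or an open edge between the two walks identifies the clusters
    have same_edge : (v, d) = (v', d') → i = j := fun h => by
      obtain ⟨rfl, rfl⟩ := Prod.mk.injEq _ _ _ _ ▸ h
      exact hsame i j v hsv hsv'
    -- what a common coin says about the two edges
    have hmem : ∀ (v : Site 2) (d : Fin 2) (x : Site 2) (d₀ : Fin 2) (l : Fin 3), ((x, d₀, l) : Coin) ∈ cert (v, d) →
        (l = 0 ∧ x = v ∧ d₀ = d) ∨
        (l = 1 ∧ ax k (v, d) ∧ x = tb k (v, d) ∧ d₀ = d ∧ ((k : ℤ) ∣ v d ∨ (tb k (v, d), d, (2 : Fin 3)) ∈ S)) ∨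
        (l = 2 ∧ ax k (v, d) ∧ x = tb k (v, d) ∧ d₀ = d ∧ ¬ (k : ℤ) ∣ v d) := by
      intro v d x d₀ l hc
      by_cases hax : ax k (v, d)
      · by_cases hdv : (k : ℤ) ∣ v d
        · simp only [hcert, hax, hdv, if_true, Set.mem_singleton_iff, Prod.mk.injEq] at hc
          obtain ⟨h1, h2, h3⟩ := hc
          exact Or.inr (Or.inl ⟨h3, hax, h1, h2, Or.inl hdv⟩)
        · by_cases hsel : (tb k (v, d), d, (2 : Fin 3)) ∈ S
          · simp only [hcert, hax, hdv, hsel, if_true, if_false, Set.mem_insert_iff, Set.mem_singleton_iff,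
              Prod.mk.injEq] at hc
            rcases hc with ⟨h1, h2, h3⟩ | ⟨h1, h2, h3⟩
            · exact Or.inr (Or.inr ⟨h3, hax, h1, h2, hdv⟩)
            · exact Or.inr (Or.inl ⟨h3, hax, h1, h2, Or.inr hsel⟩)
          · simp only [hcert, hax, hdv, hsel, if_true, if_false, Set.mem_insert_iff, Set.mem_singleton_iff,
              Prod.mk.injEq] at hc
            rcases hc with ⟨h1, h2, h3⟩ | ⟨h1, h2, h3⟩
            · exact Or.inr (Or.inr ⟨h3, hax, h1, h2, hdv⟩)
            · exact Or.inl ⟨h3, h1, h2⟩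
      · simp only [hcert, hax, if_false, Set.mem_singleton_iff, Prod.mk.injEq] at hc
        exact Or.inl ⟨hc.2.2, hc.1, hc.2.1⟩
    obtain ⟨x, d₀, l⟩ := c
    have H1 := hmem v d x d₀ l hc
    have H2 := hmem v' d' x d₀ l hc'
    fin_cases l
    · -- a common own coin: the same edge
      rcases H1 with ⟨-, rfl, rfl⟩ | ⟨h, -⟩ | ⟨h, -⟩
      · rcases H2 with ⟨-, h1, h2⟩ | ⟨h, -⟩ | ⟨h, -⟩
        · exact same_edge (by rw [h1, h2])
        · exact absurd h (by decide)
        · exact absurd h (by decide)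
      · exact absurd h (by decide)
      · exact absurd h (by decide)
    · -- a common shared coin: the same bundle, selector on (all sub-edges open) or both first sub-edges
      obtain ⟨hax, hx, hd0, hor⟩ : ax k (v, d) ∧ x = tb k (v, d) ∧ d₀ = d ∧
          ((k : ℤ) ∣ v d ∨ (tb k (v, d), d, (2 : Fin 3)) ∈ S) := by
        rcases H1 with ⟨h, -⟩ | ⟨-, h⟩ | ⟨h, -⟩
        · exact absurd h (by decide)
        · exact h
        · exact absurd h (by decide)
      obtain ⟨hax', hx', hd0', hor'⟩ : ax k (v', d') ∧ x = tb k (v', d') ∧ d₀ = d' ∧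
          ((k : ℤ) ∣ v' d' ∨ (tb k (v', d'), d', (2 : Fin 3)) ∈ S) := by
        rcases H2 with ⟨h, -⟩ | ⟨-, h⟩ | ⟨h, -⟩
        · exact absurd h (by decide)
        · exact h
        · exact absurd h (by decide)
      subst hd0
      subst hd0'
      have htb : tb k (v', d₀) = tb k (v, d₀) := hx'.symm.trans hx
      obtain ⟨p, hp, hvp⟩ := exists_pos_of_ax hk hax
      obtain ⟨p', hp', hvp'⟩ := exists_pos_of_ax hk hax'
      have hrel : ∀ i, v' i = v i + ((p' : ℤ) - p) * dirVec d₀ i := fun i => by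
        rw [hvp' i, hvp i, htb]; ring
      -- closeness of the two sub-edges identifies the clusters
      have c0 : p' = p → i = j := fun h => by
        subst h
        have : v' = v := funext fun i => by rw [hrel i]; ring
        rw [this] at hsv'
        exact hsame i j v hsv hsv'
      have c1 : p' = p + 1 → i = j := fun h => by
        subst h
        have : v' = v + dirVec d₀ := funext fun i => by rw [Pi.add_apply, hrel i]; push_cast; ring
        subst this
        exact hsame i j _ hsv1 hsv'
      have c1' : p = p' + 1 → i = j := fun h => by
        subst h
        have : v = v' + dirVec d₀ := funext fun i => by rw [Pi.add_apply, hrel i]; push_cast; ring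
        rw [this] at hsv
        exact hsame i j _ hsv hsv1'
      by_cases hsel : (tb k (v, d₀), d₀, (2 : Fin 3)) ∈ S
      · -- selector on: all (consecutive) sub-edges of the bundle are open
        have hsh : (tb k (v, d₀), d₀, (1 : Fin 3)) ∈ S := by
          have hO := (hrd S v d₀).1 hrdv
          rw [if_pos hax] at hO
          rcases hO with ⟨-, h⟩ | ⟨h, -⟩
          · exact h
          · exact absurd hsel h
        have hcases : p' = p ∨ p' = p + 1 ∨ p = p' + 1 ∨ p' = p + 2 ∨ p = p' + 2 := by omega
        rcases hcases with h | h | h | h | h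
        · exact c0 h
        · exact c1 h
        · exact c1' h
        · subst h
          have hmid : edgeOf (v + dirVec d₀, d₀) ∈ rd S := by
            have h1 := hsub (tb k (v, d₀)) d₀ (p + 1) (by omega) hsel hsh
            have heq : (fun i => (k : ℤ) * tb k (v, d₀) i + ((p + 1 : ℕ) : ℤ) * dirVec d₀ i) = v + dirVec d₀ :=
              funext fun i => by rw [Pi.add_apply, hvp i]; push_cast; ring
            rwa [heq] at h1
          have hv' : v' = v + dirVec d₀ + dirVec d₀ := funext fun i => by
            rw [Pi.add_apply, Pi.add_apply, hrel i]; push_cast; ring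
          have hadj' : (boxOpenGraph (rd S) R).Adj (v + dirVec d₀) v' := by
            refine boxOpenGraph_adj.2 ⟨?_, hbv1, hbv', fun h => ?_⟩
            · rw [hv']; exact hmid
            · have h' := congrFun h d₀
              rw [hv'] at h'
              simp only [Pi.add_apply, dirVec_apply_self] at h'
              linarith
          exact hadj i j _ _ hsv1 hsv' hadj'
        · subst h
          have hmid : edgeOf (v' + dirVec d₀, d₀) ∈ rd S := by
            have h1 := hsub (tb k (v, d₀)) d₀ (p' + 1) (by omega) hsel hsh
            have heq : (fun i => (k : ℤ) * tb k (v, d₀) i + ((p' + 1 : ℕ) : ℤ) * dirVec d₀ i) = v' + dirVec d₀ :=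
              funext fun i => by rw [Pi.add_apply, hvp' i, htb]; push_cast; ring
            rwa [heq] at h1
          have hv : v = v' + dirVec d₀ + dirVec d₀ := funext fun i => by
            rw [Pi.add_apply, Pi.add_apply, hrel i]; push_cast; ring
          have hadj' : (boxOpenGraph (rd S) R).Adj (v' + dirVec d₀) v := by
            refine boxOpenGraph_adj.2 ⟨?_, hbv1', hbv, fun h => ?_⟩
            · rw [hv]; exact hmid
            · have h' := congrFun h d₀
              rw [hv] at h'
              simp only [Pi.add_apply, dirVec_apply_self] at h'
              linarith
          exact (hadj j i _ _ hsv1' hsv hadj').symm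
      · -- selector off: both edges are the first sub-edge of the bundle
        have hdv : (k : ℤ) ∣ v d₀ := hor.resolve_right hsel
        have hdv' : (k : ℤ) ∣ v' d₀ := hor'.resolve_right (by rwa [htb])
        have hp0 : p = 0 := (pos_eq_zero_iff hp hvp).1 hdv
        have hp0' : p' = 0 := (pos_eq_zero_iff hp' hvp').1 hdv'
        exact c0 (hp0'.trans hp0.symm)
    · -- a common selector: two non-first sub-edges of the same bundle, which are consecutive
      obtain ⟨hax, hx, hd0, hndv⟩ : ax k (v, d) ∧ x = tb k (v, d) ∧ d₀ = d ∧ ¬ (k : ℤ) ∣ v d := by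
        rcases H1 with ⟨h, -⟩ | ⟨h, -⟩ | ⟨-, h⟩
        · exact absurd h (by decide)
        · exact absurd h (by decide)
        · exact h
      obtain ⟨hax', hx', hd0', hndv'⟩ : ax k (v', d') ∧ x = tb k (v', d') ∧ d₀ = d' ∧ ¬ (k : ℤ) ∣ v' d' := by
        rcases H2 with ⟨h, -⟩ | ⟨h, -⟩ | ⟨-, h⟩
        · exact absurd h (by decide)
        · exact absurd h (by decide)
        · exact h
      subst hd0
      subst hd0'
      have htb : tb k (v', d₀) = tb k (v, d₀) := hx'.symm.trans hx
      obtain ⟨p, hp, hvp⟩ := exists_pos_of_ax hk hax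
      obtain ⟨p', hp', hvp'⟩ := exists_pos_of_ax hk hax'
      have hrel : ∀ i, v' i = v i + ((p' : ℤ) - p) * dirVec d₀ i := fun i => by
        rw [hvp' i, hvp i, htb]; ring
      have hp0 : p ≠ 0 := fun h => hndv ((pos_eq_zero_iff hp hvp).2 h)
      have hp0' : p' ≠ 0 := fun h => hndv' ((pos_eq_zero_iff hp' hvp').2 h)
      have hcases : p' = p ∨ p' = p + 1 ∨ p = p' + 1 := by omega
      rcases hcases with h | h | h
      · subst h
        have : v' = v := funext fun i => by rw [hrel i]; ring
        rw [this] at hsv'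
        exact hsame i j v hsv hsv'
      · subst h
        have : v' = v + dirVec d₀ := funext fun i => by rw [Pi.add_apply, hrel i]; push_cast; ring
        subst this
        exact hsame i j _ hsv1 hsv'
      · subst h
        have : v = v' + dirVec d₀ := funext fun i => by rw [Pi.add_apply, hrel i]; push_cast; ring
        rw [this] at hsv
        exact hsame i j _ hsv hsv1'

/-! ### The tail bound -/

/-- **BK-type tail bound for the number of crossing clusters under `M_k`, `k ≤ 3`** (registered
helper of the stub `stub_fourArmAboveOne`; the `M_k`-analogue of the tree's
`real_le_numCrossingClusters_le` before the RSW input): for every `n`,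
`M_k(q)(Z ≥ n) ≤ M_k(q)(A)^n`, where `Z = numCrossingClusters · N R` and `A = boxCrossingEvent N R`
is the open crossing from `B(N)` to `‖·‖_∞ = R`.  Proof: realise `M_k(q)` through the second
read-out of the coins (`exists_readout`), pull `{Z ≥ n}` back into the `n`-fold coin-disjoint
occurrence of the pull-back of `A` (`readout_preimage_subset_disjointOccurrencePow`), and iterate
Reimer's inequality on the coin product (`prodBernoulli_real_disjointOccurrencePow_le`). -/
theorem M_real_setOf_le_numCrossingClusters_le_pow {k : ℕ} (hk : 0 < k) (hk3 : k ≤ 3) (q : ℝ × ℝ)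
    (N R n : ℕ) :
    (M k q.1 q.2).real {ω | n ≤ numCrossingClusters ω N R} ≤
      ((M k q.1 q.2).real (boxCrossingEvent N R)) ^ n := by
  obtain ⟨rd, hrdm, hlaw, hrde, hrd⟩ := exists_readout hk q
  have hZm : MeasurableSet {ω : BondConfig (Site 2) | n ≤ numCrossingClusters ω N R} :=
    measurableSet_of_isLocalEvent_holds (isLocalEvent_setOf_numCrossingClusters N R (n ≤ ·))
  have hAm : MeasurableSet (boxCrossingEvent N R) :=
    measurableSet_of_isLocalEvent_holds (isLocalEvent_boxCrossingEvent N R)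
  rw [← hlaw, map_measureReal_apply hrdm hZm, map_measureReal_apply hrdm hAm]
  have hloc : IsLocalEvent (rd ⁻¹' boxCrossingEvent N R) :=
    ⟨_, determinedBy_preimage_readout hrd hrde (determinedBy_boxCrossingEvent N R)⟩
  calc (coinLaw k q).real (rd ⁻¹' {ω | n ≤ numCrossingClusters ω N R})
      ≤ (coinLaw k q).real (disjointOccurrencePow (rd ⁻¹' boxCrossingEvent N R) n) :=
        measureReal_mono (readout_preimage_subset_disjointOccurrencePow hk hk3 hrd hrde N R n)
    _ ≤ ((coinLaw k q).real (rd ⁻¹' boxCrossingEvent N R)) ^ n :=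
        prodBernoulli_real_disjointOccurrencePow_le (prm k q.1 q.2) hloc n

end Summit.CriticalPhenomena.CardyFormulaZ2.Theorems.CardySelfRefinement.FarField

end
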